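import Summits.PneNP.PneNP.Theorems.ConvexRankGatesCliqueExtLowerBoundStubNarrowAlgebraicHelpers
import Summits.PneNP.PneNP.Theorems.ConvexRankGatesCliqueExtLowerBoundRealInline

/-!
# Wideness is free: the `∧`-padding of a gate (`not_narrow_andPad` and basics)
(crux `ConvexRankGates.CliqueExtLowerBound`, stmt-PneNP-10682; line `width-threshold-certificate-sparsity`,
reshape r8 of lead c12 — the side conditions "not narrow" of the r7 leaves are idle)

The r7 leaves `stub_permCnf` / `stub_grankCnf` exclude the NARROW gates (PERM or GRANK of width
`≤ T = ⌊m^{1/16}⌋₊`). The exclusion is idle: pad a gate `φ` of fan-in `n` with `n'` dummy wires and take the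
conjunction,
  `andPad φ n' := ⟨n + n', v ↦ φ (v ∘ castAdd) && [∀ j, v (natAdd n j)]⟩`
(written inline below — no definition is introduced), feed the dummies with the constant-true (empty) CNF, and
the composed Boolean function of the edges is unchanged (`andPad_cval`), while every accepted wire pattern of the
padded gate has all `n'` dummies on, so by the landed minterm bound of narrow algebraic gates
(`NarrowAlgebraicHelpers.narrowAlgebraic_shortMinterms`: every accepted input of a PERM/GRANK gate of width `≤ T`
dominates an accepted pattern of `≤ T(log₂ T + 1)` on-wires) the padded gate is NOT narrow as soon as
`n' > T (log₂ T + 1)` and `φ` accepts something (`not_narrow_andPad`, REGISTERED). That the padded gate is again a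
PERM gate (on `2n'` more points) / a GRANK gate (of dimension `d + (d+1)n'`) is proved in the companion files of
wave 2; the numerics of the level shift `c ↦ c+1` are `eventually_pad_numerics`.
-/

set_option linter.dupNamespace false

open Literature.Computability.Complexity Filter Finset

namespace Summit.PneNP.PneNP.Theorems.CliqueExtLowerBound.WidthThreshold.AndPad

open Summit.PneNP.PneNP.Theorems.CliqueExtLowerBound.WidthThreshold.NarrowAlgebraicHelpers
  (narrowAlgebraic_shortMinterms)
open Summit.PneNP.PneNP.Theorems.CliqueExtLowerBound.WidthThreshold.RealInline (floor_pow_sixteen_le)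

/-! ## §1 The padded gate: acceptance and the composed function -/

/-- Acceptance of the padded gate: the old part accepts and every dummy is on. [folklore] -/
theorem andPad_apply (φ : GateFn) (n' : ℕ) (v : Fin (φ.1 + n') → Bool) :
    (⟨φ.1 + n', fun v => φ.2 (fun i => v (Fin.castAdd n' i)) &&
        decide (∀ j : Fin n', v (Fin.natAdd φ.1 j) = true)⟩ : GateFn).2 v = true ↔
      φ.2 (fun i => v (Fin.castAdd n' i)) = true ∧ ∀ j : Fin n', v (Fin.natAdd φ.1 j) = true := by
  simp [Bool.and_eq_true]

open Classical in
/-- The padded children: the old CNFs on the old wires, the EMPTY (constant-true) CNF on the dummies; written with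
`Fin.addCases`. Reading them returns the old reading on the old wires and `true` on the dummies, so the composed
function of the padded gate equals the composed function of `φ`. [folklore] -/
theorem andPad_cval {ι : Type} (φ : GateFn) (n' : ℕ) (C : Fin φ.1 → Finset (Finset ι)) (x : ι → Bool) :
    (⟨φ.1 + n', fun v => φ.2 (fun i => v (Fin.castAdd n' i)) &&
        decide (∀ j : Fin n', v (Fin.natAdd φ.1 j) = true)⟩ : GateFn).2
        (fun j => decide (EvalCNF (Fin.addCases (motive := fun _ => Finset (Finset ι)) C (fun _ : Fin n' => (∅ : Finset (Finset ι))) j) x)) =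
      φ.2 (fun j => decide (EvalCNF (C j) x)) := by
  have hold : (fun i : Fin φ.1 => decide (EvalCNF
      (Fin.addCases (motive := fun _ => Finset (Finset ι)) C (fun _ : Fin n' => (∅ : Finset (Finset ι))) (Fin.castAdd n' i)) x)) =
      fun j => decide (EvalCNF (C j) x) := by
    funext i
    rw [Fin.addCases_left]
  have hnew : ∀ j : Fin n', decide (EvalCNF
      (Fin.addCases (motive := fun _ => Finset (Finset ι)) C (fun _ : Fin n' => (∅ : Finset (Finset ι))) (Fin.natAdd φ.1 j)) x) = true := by
    intro j
    rw [Fin.addCases_right]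
    simp [EvalCNF]
  show (φ.2 (fun i : Fin φ.1 => decide (EvalCNF
      (Fin.addCases (motive := fun _ => Finset (Finset ι)) C (fun _ : Fin n' => (∅ : Finset (Finset ι))) (Fin.castAdd n' i)) x)) &&
      decide (∀ j : Fin n', decide (EvalCNF
        (Fin.addCases (motive := fun _ => Finset (Finset ι)) C (fun _ : Fin n' => (∅ : Finset (Finset ι))) (Fin.natAdd φ.1 j)) x) = true)) = _
  rw [hold]
  have : decide (∀ j : Fin n', decide (EvalCNF
      (Fin.addCases (motive := fun _ => Finset (Finset ι)) C (fun _ : Fin n' => (∅ : Finset (Finset ι))) (Fin.natAdd φ.1 j)) x) = true) =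
      true := decide_eq_true fun j => hnew j
  rw [this, Bool.and_true]

/-- The padded children have at most one more DISTINCT member than the old ones (the empty CNF). [folklore] -/
theorem card_image_andPad_le {ι : Type} [DecidableEq ι] (φ : GateFn) (n' : ℕ) (C : Fin φ.1 → Finset (Finset ι)) :
    #(univ.image (Fin.addCases (motive := fun _ => Finset (Finset ι)) C (fun _ : Fin n' => (∅ : Finset (Finset ι))))) ≤ #(univ.image C) + 1 := by
  classical
  have hsub : univ.image (Fin.addCases (motive := fun _ => Finset (Finset ι)) C (fun _ : Fin n' => (∅ : Finset (Finset ι)))) ⊆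
      univ.image C ∪ {∅} := by
    intro F hF
    obtain ⟨j, -, rfl⟩ := mem_image.1 hF
    refine Fin.addCases (motive := fun j => Fin.addCases (motive := fun _ => Finset (Finset ι)) C (fun _ : Fin n' => (∅ : Finset (Finset ι))) j ∈
      univ.image C ∪ {∅}) (fun i => ?_) (fun i => ?_) j
    · rw [Fin.addCases_left]
      exact mem_union_left _ (mem_image_of_mem _ (mem_univ _))
    · rw [Fin.addCases_right]
      exact mem_union_right _ (mem_singleton_self _)
  calc _ ≤ #(univ.image C ∪ {∅}) := card_le_card hsub
    _ ≤ #(univ.image C) + #({∅} : Finset (Finset (Finset ι))) := card_union_le _ _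
    _ = #(univ.image C) + 1 := by rw [card_singleton]

/-- The padded children are as local as the old ones. [folklore] -/
theorem andPad_local {ι : Type} (φ : GateFn) (n' s : ℕ) (C : Fin φ.1 → Finset (Finset ι))
    (hC : ∀ j, ∀ S ∈ C j, #S ≤ s - 1) :
    ∀ j, ∀ S ∈ Fin.addCases (motive := fun _ => Finset (Finset ι)) C (fun _ : Fin n' => (∅ : Finset (Finset ι))) j, #S ≤ s - 1 := by
  intro j
  refine Fin.addCases (motive := fun j =>
    ∀ S ∈ Fin.addCases (motive := fun _ => Finset (Finset ι)) C (fun _ : Fin n' => (∅ : Finset (Finset ι))) j, #S ≤ s - 1)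
    (fun i => ?_) (fun i => ?_) j
  · rw [Fin.addCases_left]
    exact hC i
  · rw [Fin.addCases_right]
    intro S hS
    simp at hS

/-! ## §2 The padded gate is not narrow (REGISTERED `not_narrow_andPad`) -/

/-- REGISTERED SUB-GOAL `not_narrow_andPad` (reshape r8). If `φ` accepts some input and the number of dummies
exceeds `T (log₂ T + 1)`, the `∧`-padded gate is neither a PERM nor a GRANK gate of width `≤ T`: an accepted input
of a narrow algebraic gate dominates an accepted pattern with `≤ T(log₂ T + 1)` on-wires
(`narrowAlgebraic_shortMinterms`), but every accepted pattern of the padded gate has all `n'` dummies on. [folklore] -/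
theorem not_narrow_andPad : ∀ (T n' : ℕ) (φ : GateFn), (∃ v, φ.2 v = true) → T * (Nat.log 2 T + 1) < n' →
    ¬ (IsPermGate T ⟨φ.1 + n', fun v => φ.2 (fun i => v (Fin.castAdd n' i)) &&
        decide (∀ j : Fin n', v (Fin.natAdd φ.1 j) = true)⟩ ∨
      IsGRankGate T ⟨φ.1 + n', fun v => φ.2 (fun i => v (Fin.castAdd n' i)) &&
        decide (∀ j : Fin n', v (Fin.natAdd φ.1 j) = true)⟩) := by
  intro T n' φ ⟨v₀, hv₀⟩ hn' hnarrow
  obtain ⟨-, hmin⟩ := narrowAlgebraic_shortMinterms T _ hnarrow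
  -- the accepted input: `v₀` on the old wires, everything on on the dummies
  set v₁ : Fin (φ.1 + n') → Bool := Fin.addCases (motive := fun _ => Bool) v₀ (fun _ : Fin n' => true) with hv₁
  have hold : (fun i => v₁ (Fin.castAdd n' i)) = v₀ := funext fun i => by rw [hv₁, Fin.addCases_left]
  have hacc : (⟨φ.1 + n', fun v => φ.2 (fun i => v (Fin.castAdd n' i)) &&
      decide (∀ j : Fin n', v (Fin.natAdd φ.1 j) = true)⟩ : GateFn).2 v₁ = true :=
    (andPad_apply φ n' v₁).2 ⟨by rw [hold, hv₀], fun j => by rw [hv₁, Fin.addCases_right]⟩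
  obtain ⟨S, hScard, -, hSacc⟩ := hmin v₁ hacc
  -- every dummy is in `S`
  have hdummy : ∀ j : Fin n', Fin.natAdd φ.1 j ∈ S := fun j => by
    have := ((andPad_apply φ n' _).1 hSacc).2 j
    simpa using this
  have hle : n' ≤ #S := by
    calc n' = #((univ : Finset (Fin n')).image fun j => Fin.natAdd φ.1 j) := by
          rw [card_image_of_injective _ fun a b h => by simpa using h, card_univ, Fintype.card_fin]
      _ ≤ #S := card_le_card fun i hi => by
          obtain ⟨j, -, rfl⟩ := mem_image.1 hi
          exact hdummy j
  omega

/-! ## §3 Numerics of the level shift `c ↦ c + 1` -/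

/-- `T (log₂ T + 1) ≤ T² + T`. [folklore] -/
theorem narrowLen_le (T : ℕ) : T * (Nat.log 2 T + 1) ≤ T * T + T := by
  have h : Nat.log 2 T ≤ T := Nat.log_le_self 2 T
  nlinarith

/-- With `T = ⌊m^{1/16}⌋₊` and `L = T(log₂ T + 1)`: `2L + 3 ≤ m` and `2T ≤ m` once `m ≥ 5`. [folklore] -/
theorem two_narrowLen_add_three_le {m : ℕ} (hm : 5 ≤ m) :
    2 * (⌊(m : ℝ) ^ (1 / 16 : ℝ)⌋₊ * (Nat.log 2 ⌊(m : ℝ) ^ (1 / 16 : ℝ)⌋₊ + 1)) + 3 ≤ m ∧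
      2 * ⌊(m : ℝ) ^ (1 / 16 : ℝ)⌋₊ ≤ m := by
  set T := ⌊(m : ℝ) ^ (1 / 16 : ℝ)⌋₊ with hT
  have h16 : T ^ 16 ≤ m := floor_pow_sixteen_le m
  have hlen := narrowLen_le T
  rcases Nat.lt_or_ge T 2 with hT2 | hT2
  · interval_cases T <;> simp [Nat.log_one_right] at hlen ⊢ <;> omega
  · -- `T ≥ 2`: `2(T²+T)+3 ≤ 7 T² ≤ T⁵ ≤ T^16 ≤ m` and `2T ≤ T² ≤ T^16`
    have hT3 : 7 ≤ T ^ 3 := by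
      calc 7 ≤ 2 ^ 3 := by norm_num
        _ ≤ T ^ 3 := Nat.pow_le_pow_left hT2 3
    have h1 : 2 * (T * T + T) + 3 ≤ 7 * (T * T) := by nlinarith
    have h2 : 7 * (T * T) ≤ T ^ 16 := by
      calc 7 * (T * T) ≤ T ^ 3 * (T * T) := Nat.mul_le_mul_right _ hT3
        _ = T ^ 5 := by ring
        _ ≤ T ^ 16 := Nat.pow_le_pow_right (by omega) (by norm_num)
    have h3 : 2 * T ≤ T ^ 16 := by
      calc 2 * T ≤ T * T := Nat.mul_le_mul_right _ hT2
        _ = T ^ 2 := by ring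
        _ ≤ T ^ 16 := Nat.pow_le_pow_right (by omega) (by norm_num)
    constructor <;> omega

/-- **Level-shift numerics.** For every `c`, for all large `m`, with `T = ⌊m^{1/16}⌋₊` and `n' := T(log₂T+1) + 1`
dummies: the PERM padding fits (`m^c + 2 n' ≤ m^{c+1}`), the GRANK padding fits (`m^c + (m^c + 1) n' ≤ m^{c+1}`),
the CONV padding fits (`m^c + (T + 1) + (c + 3) ≤ m^{c+1}`), one more distinct child fits
(`m^{c+3} + 1 ≤ m^{(c+1)+3}`), and the error only improves (`8 m^{c+1} ≤ 8 m^{(c+1)+1}`). [folklore] -/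
theorem eventually_pad_numerics (c : ℕ) : ∀ᶠ m : ℕ in atTop,
    m ^ c + 2 * (⌊(m : ℝ) ^ (1 / 16 : ℝ)⌋₊ * (Nat.log 2 ⌊(m : ℝ) ^ (1 / 16 : ℝ)⌋₊ + 1) + 1) ≤ m ^ (c + 1) ∧
    m ^ c + (m ^ c + 1) * (⌊(m : ℝ) ^ (1 / 16 : ℝ)⌋₊ * (Nat.log 2 ⌊(m : ℝ) ^ (1 / 16 : ℝ)⌋₊ + 1) + 1) ≤
      m ^ (c + 1) ∧
    m ^ c + (⌊(m : ℝ) ^ (1 / 16 : ℝ)⌋₊ + 1) + (c + 3) ≤ m ^ (c + 1) ∧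
    m ^ (c + 3) + 1 ≤ m ^ (c + 1 + 3) ∧ 8 * m ^ (c + 1) ≤ 8 * m ^ (c + 1 + 1) := by
  filter_upwards [eventually_ge_atTop (2 * c + 12)] with m hm
  obtain ⟨hL3, hT2⟩ := two_narrowLen_add_three_le (m := m) (by omega)
  set T := ⌊(m : ℝ) ^ (1 / 16 : ℝ)⌋₊ with hT
  set L := T * (Nat.log 2 T + 1) with hL
  have hTc : T + c + 5 ≤ m := by omega
  have hm1 : 1 ≤ m := by omega
  have hmc : 1 ≤ m ^ c := Nat.one_le_pow _ _ hm1
  have hpow : m ^ (c + 1) = m ^ c * m := pow_succ m c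
  -- `m^c · m + 1 ≥ m^c + m` (for `c ≥ 1` even without the `+ 1`)
  have hkey : m ^ c + m ≤ m ^ c * m + 1 := by
    rcases Nat.eq_zero_or_pos c with rfl | hc
    · simp; omega
    · have : m ≤ m ^ c := by
        calc m = m ^ 1 := (pow_one m).symm
          _ ≤ m ^ c := Nat.pow_le_pow_right hm1 hc
      nlinarith
  refine ⟨?_, ?_, ?_, ?_, ?_⟩
  · -- PERM
    rw [hpow]; omega
  · -- GRANK: `(m^c + 1)(L+1) ≤ 2 m^c (L+1)`, so the left side is `≤ m^c (2L+3) ≤ m^c · m`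
    rw [hpow]
    have h1 : (m ^ c + 1) * (L + 1) ≤ 2 * m ^ c * (L + 1) := by nlinarith
    have h2 : m ^ c + 2 * m ^ c * (L + 1) = m ^ c * (2 * L + 3) := by ring
    have h3 : m ^ c * (2 * L + 3) ≤ m ^ c * m := Nat.mul_le_mul_left _ hL3
    omega
  · -- CONV
    rw [hpow]; omega
  · -- children
    have : m ^ (c + 1 + 3) = m ^ (c + 3) * m := by ring
    rw [this]
    have h1 : 1 ≤ m ^ (c + 3) := Nat.one_le_pow _ _ hm1
    nlinarith
  · -- error
    have : m ^ (c + 1 + 1) = m ^ (c + 1) * m := by ring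
    rw [this]
    have h1 : 1 ≤ m ^ (c + 1) := Nat.one_le_pow _ _ hm1
    nlinarith

end Summit.PneNP.PneNP.Theorems.CliqueExtLowerBound.WidthThreshold.AndPad
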